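import Mathlib.MeasureTheory.Function.L2Space
import Mathlib.Analysis.InnerProductSpace.Adjoint
import Literature.Analysis.OperatorTheory.HermitianKernelOperator
import HarnessLib

/-!
# Stub `stub_mulInvolutionOp` of line `twisted_trace_transfer`
# for crux `QuarksAsStableAction.StableActionBridge` (item stmt-QuantumFields-9737)

This file proves the registered stub `stub_mulInvolutionOp` (sub-goal D1, Wave 3 of step E3 of the
lead skeleton of line `twisted_trace_transfer`): **a `±1`-valued measurable weight acts on `L²` as a
self-adjoint unitary involution commuting with every kernel operator whose kernel it intertwines.**

Step E3 realises the lattice-QCD transfer matrix as a compact self-adjoint integral operator `A` on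
`L²(ρ; ℂ)` over a finite measure space and needs the fermion parity `(−1)^F` as an honest bounded
operator `F` on `L²`: multiplication by a measurable weight `w : Y → ℝ` with `w = ±1`.  For such a
`w` we show that there is a bounded `F` on `Lp ℂ 2 ρ` with

1. `F φ = w · φ` a.e. for every `φ`;
2. `F` self-adjoint (`w` is real);
3. `F * F = 1` (`w² = 1`);
4. `A * F = F * A` for every bounded operator `A` given a.e. by a kernel `K` with the parity
   selection rule `K(x, y) w(y) = w(x) K(x, y)`;
5. `⟪φ, F φ⟫ = ∫ w |φ|² dρ`.

## Proof

* Construction (`StubMulInvolutionOp.exists_clm_ae_mul`): for `φ ∈ L²`, `y ↦ w(y) φ(y)` is in `L²`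
  (`MemLp.of_le` with `‖w(y) φ(y)‖ = ‖φ(y)‖`, `StubMulInvolutionOp.memLp_ofReal_mul`); the map
  `φ ↦ toLp (w φ)` is linear (`MemLp.toLp_add`, `MemLp.toLp_const_smul`, `Lp.coeFn_add`,
  `Lp.coeFn_smul`) and bounded by `1` (`Lp.norm_le_norm_of_ae_le`), so `LinearMap.mkContinuous`
  gives `F`; the a.e. formula is `MemLp.coeFn_toLp`.
* Every further property is proved for ANY bounded `F` with the a.e. formula:
  `⟪ψ, F φ⟫ = ∫ conj ψ · w φ` (`L2.inner_def`, `StubMulInvolutionOp.inner_apply_eq`), whence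
  self-adjointness (`integral_conj`, `Complex.conj_ofReal`) and the diagonal formula
  (`Complex.conj_mul'`); `F * F = 1` by `Lp.ext` and `w(y)² = 1`; and the commutation by comparing the
  a.e. representatives `x ↦ ∫ K(x,y) w(y) φ(y) dρ(y)` of `A (F φ)` (`integral_congr_ae`) and
  `x ↦ w(x) ∫ K(x,y) φ(y) dρ(y)` of `F (A φ)` (`integral_const_mul`), whose integrands agree pointwise
  by the intertwining hypothesis (no integrability is needed for this step).

Pure theorem file (no definitions); helpers live in the sub-namespace `StubMulInvolutionOp`.
Mathlib only (the `Literature` import fixes the ambient kernel-operator API of E3). [folklore]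
-/

noncomputable section

open MeasureTheory Filter
open scoped InnerProductSpace ComplexConjugate ENNReal

namespace Summit.QuantumFields.QCD.Cruxes.StableActionBridge.TwistedTraceTransfer

namespace StubMulInvolutionOp

variable {Y : Type*} {w : Y → ℝ}

/-- A `±1`-valued weight has complex modulus one: `‖(w y : ℂ)‖ = 1`. [folklore] -/
theorem norm_ofReal_eq_one (hw1 : ∀ y, w y = 1 ∨ w y = -1) (y : Y) : ‖(w y : ℂ)‖ = 1 := by
  rcases hw1 y with h | h <;> simp [h]

/-- A `±1`-valued weight squares to one in `ℂ`: `w y * w y = 1`. [folklore] -/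
theorem ofReal_mul_ofReal_eq_one (hw1 : ∀ y, w y = 1 ∨ w y = -1) (y : Y) :
    (w y : ℂ) * (w y : ℂ) = 1 := by
  rcases hw1 y with h | h <;> simp [h]

variable [MeasurableSpace Y] {ρ : Measure Y}

/-- For `φ ∈ L²(ρ; ℂ)` and a measurable `±1`-valued weight `w`, `y ↦ w(y) φ(y)` is in `L²`
(`MemLp.of_le`: same modulus as `φ`). [folklore] -/
theorem memLp_ofReal_mul (hw : Measurable w) (hw1 : ∀ y, w y = 1 ∨ w y = -1) (φ : Lp ℂ 2 ρ) :
    MemLp (fun y => (w y : ℂ) * φ y) 2 ρ :=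
  MemLp.of_le (Lp.memLp φ)
    ((Complex.measurable_ofReal.comp hw).aestronglyMeasurable.mul (Lp.aestronglyMeasurable φ))
    (Eventually.of_forall fun y => by rw [norm_mul, norm_ofReal_eq_one hw1 y, one_mul])

/-- **The multiplication operator by a measurable `±1`-valued weight on `L²(ρ; ℂ)`** exists as a
bounded operator: there is `F : L² →L[ℂ] L²` with `F φ = w · φ` a.e. for every `φ`
(`LinearMap.mkContinuous` with bound `1`). [folklore] -/
theorem exists_clm_ae_mul (hw : Measurable w) (hw1 : ∀ y, w y = 1 ∨ w y = -1) :
    ∃ F : Lp ℂ 2 ρ →L[ℂ] Lp ℂ 2 ρ,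
      ∀ φ : Lp ℂ 2 ρ, (F φ : Y → ℂ) =ᵐ[ρ] fun y => (w y : ℂ) * φ y := by
  have hmem : ∀ φ : Lp ℂ 2 ρ, MemLp (fun y => (w y : ℂ) * φ y) 2 ρ := fun φ =>
    memLp_ofReal_mul hw hw1 φ
  let L : Lp ℂ 2 ρ →ₗ[ℂ] Lp ℂ 2 ρ :=
    { toFun := fun φ => (hmem φ).toLp _
      map_add' := fun φ ψ => by
        rw [← MemLp.toLp_add (hmem φ) (hmem ψ), MemLp.toLp_eq_toLp_iff]
        filter_upwards [Lp.coeFn_add φ ψ] with y hy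
        simp only [hy, Pi.add_apply, mul_add]
      map_smul' := fun c φ => by
        rw [RingHom.id_apply, ← MemLp.toLp_const_smul, MemLp.toLp_eq_toLp_iff]
        filter_upwards [Lp.coeFn_smul c φ] with y hy
        simp only [hy, Pi.smul_apply, smul_eq_mul]
        ring }
  have hL : ∀ φ : Lp ℂ 2 ρ, (L φ : Y → ℂ) =ᵐ[ρ] fun y => (w y : ℂ) * φ y := fun φ =>
    (hmem φ).coeFn_toLp
  have hbound : ∀ φ : Lp ℂ 2 ρ, ‖L φ‖ ≤ 1 * ‖φ‖ := by
    intro φ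
    rw [one_mul]
    refine Lp.norm_le_norm_of_ae_le ?_
    filter_upwards [hL φ] with y hy
    rw [hy, norm_mul, norm_ofReal_eq_one hw1 y, one_mul]
  exact ⟨L.mkContinuous 1 hbound, fun φ => hL φ⟩

variable {F : Lp ℂ 2 ρ →L[ℂ] Lp ℂ 2 ρ}

/-- Matrix elements of an operator given a.e. by multiplication by `w`:
`⟪ψ, F φ⟫ = ∫ conj ψ(y) (w(y) φ(y)) dρ(y)` (`L2.inner_def`). [folklore] -/
theorem inner_apply_eq (hF : ∀ φ : Lp ℂ 2 ρ, (F φ : Y → ℂ) =ᵐ[ρ] fun y => (w y : ℂ) * φ y)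
    (ψ φ : Lp ℂ 2 ρ) : ⟪ψ, F φ⟫_ℂ = ∫ y, conj ((ψ : Y → ℂ) y) * ((w y : ℂ) * φ y) ∂ρ := by
  rw [L2.inner_def]
  refine integral_congr_ae ?_
  filter_upwards [hF φ] with y hy
  rw [RCLike.inner_apply', hy]

/-- An operator given a.e. by multiplication by a REAL weight is self-adjoint. [folklore] -/
theorem isSelfAdjoint_of_ae_mul
    (hF : ∀ φ : Lp ℂ 2 ρ, (F φ : Y → ℂ) =ᵐ[ρ] fun y => (w y : ℂ) * φ y) : IsSelfAdjoint F := by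
  rw [ContinuousLinearMap.isSelfAdjoint_iff_isSymmetric]
  intro φ ψ
  change ⟪F φ, ψ⟫_ℂ = ⟪φ, F ψ⟫_ℂ
  rw [← inner_conj_symm (F φ) ψ, inner_apply_eq hF ψ φ, inner_apply_eq hF φ ψ, ← integral_conj]
  refine integral_congr_ae (Eventually.of_forall fun y => ?_)
  simp only [map_mul, Complex.conj_conj, Complex.conj_ofReal]
  ring

/-- An operator given a.e. by multiplication by a `±1`-valued weight is an involution:
`F * F = 1` (`Lp.ext`, `w² = 1`). [folklore] -/
theorem mul_self_of_ae_mul (hw1 : ∀ y, w y = 1 ∨ w y = -1)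
    (hF : ∀ φ : Lp ℂ 2 ρ, (F φ : Y → ℂ) =ᵐ[ρ] fun y => (w y : ℂ) * φ y) : F * F = 1 := by
  refine ContinuousLinearMap.ext fun φ => Lp.ext ?_
  rw [mul_apply_eq_comp, one_apply_eq_self]
  filter_upwards [hF (F φ), hF φ] with y h1 h2
  rw [h1, h2, ← mul_assoc, ofReal_mul_ofReal_eq_one hw1 y, one_mul]

/-- **Parity selection rule ⇒ commutation.** If `A` is given a.e. by a kernel `K` with
`K(x, y) w(y) = w(x) K(x, y)` and `F` a.e. by multiplication by `w`, then `A * F = F * A`: both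
`A (F φ)` and `F (A φ)` are represented a.e. by `x ↦ ∫ w(x) K(x, y) φ(y) dρ(y)`
(`integral_congr_ae`, `integral_const_mul`; no integrability needed). [folklore] -/
theorem mul_eq_mul_of_ae_kernel
    (hF : ∀ φ : Lp ℂ 2 ρ, (F φ : Y → ℂ) =ᵐ[ρ] fun y => (w y : ℂ) * φ y) {K : Y → Y → ℂ}
    (hKw : ∀ x y, K x y * (w y : ℂ) = (w x : ℂ) * K x y) {A : Lp ℂ 2 ρ →L[ℂ] Lp ℂ 2 ρ}
    (hA : ∀ φ : Lp ℂ 2 ρ, (A φ : Y → ℂ) =ᵐ[ρ] fun x => ∫ y, K x y * φ y ∂ρ) :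
    A * F = F * A := by
  refine ContinuousLinearMap.ext fun φ => Lp.ext ?_
  rw [mul_apply_eq_comp, mul_apply_eq_comp]
  have hAF : (A (F φ) : Y → ℂ) =ᵐ[ρ] fun x => ∫ y, K x y * ((w y : ℂ) * φ y) ∂ρ := by
    filter_upwards [hA (F φ)] with x hx
    rw [hx]
    refine integral_congr_ae ?_
    filter_upwards [hF φ] with y hy
    rw [hy]
  have hFA : (F (A φ) : Y → ℂ) =ᵐ[ρ] fun x => (w x : ℂ) * ∫ y, K x y * φ y ∂ρ := by
    filter_upwards [hF (A φ), hA φ] with x hx hx'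
    rw [hx, hx']
  filter_upwards [hAF, hFA] with x h1 h2
  rw [h1, h2, ← integral_const_mul]
  refine integral_congr_ae (Eventually.of_forall fun y => ?_)
  dsimp only
  rw [← mul_assoc, hKw x y, mul_assoc]

/-- Diagonal matrix elements: `⟪φ, F φ⟫ = ∫ w(y) ‖φ(y)‖² dρ(y)` for an operator given a.e. by
multiplication by the real weight `w` (`Complex.conj_mul'`). [folklore] -/
theorem inner_self_apply_eq
    (hF : ∀ φ : Lp ℂ 2 ρ, (F φ : Y → ℂ) =ᵐ[ρ] fun y => (w y : ℂ) * φ y) (φ : Lp ℂ 2 ρ) :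
    ⟪φ, F φ⟫_ℂ = ∫ y, (w y : ℂ) * ((‖(φ : Y → ℂ) y‖ ^ 2 : ℝ) : ℂ) ∂ρ := by
  rw [inner_apply_eq hF φ φ]
  refine integral_congr_ae (Eventually.of_forall fun y => ?_)
  dsimp only
  rw [mul_left_comm, Complex.conj_mul', Complex.ofReal_pow]

end StubMulInvolutionOp

/-- **Sub-goal D1 (registered stub `stub_mulInvolutionOp`; abstract): a `±1`-valued measurable
weight acts on `L²` as a self-adjoint unitary involution commuting with every kernel operator whose
kernel it intertwines.**  For `w : Y → ℝ` measurable with `w = ±1` there is a bounded `F` on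
`L²(ρ; ℂ)` with `F φ =ᵐ w · φ`, `F` self-adjoint, `F² = 1`; `A F = F A` for the integral operator
`A` of any bounded strongly measurable kernel with `K(x,y) w(y) = w(x) K(x,y)`; and
`⟪φ, F φ⟫ = ∫ w |φ|²`.  In E3, `w = (−1)^{#s}` is fermion parity. [folklore] -/
theorem stub_mulInvolutionOp : ∀ (Y : Type) [MeasurableSpace Y] (ρ : Measure Y) [IsFiniteMeasure ρ]
    (w : Y → ℝ), Measurable w → (∀ y, w y = 1 ∨ w y = -1) →
    ∃ F : Lp ℂ 2 ρ →L[ℂ] Lp ℂ 2 ρ,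
      (∀ φ : Lp ℂ 2 ρ, (F φ : Y → ℂ) =ᵐ[ρ] fun y => (w y : ℂ) * φ y) ∧ IsSelfAdjoint F ∧ F * F = 1 ∧
      (∀ (K : Y → Y → ℂ) (C : ℝ), StronglyMeasurable (Function.uncurry K) → (∀ x y, ‖K x y‖ ≤ C) →
        (∀ x y, K x y * (w y : ℂ) = (w x : ℂ) * K x y) →
        ∀ A : Lp ℂ 2 ρ →L[ℂ] Lp ℂ 2 ρ, (∀ φ : Lp ℂ 2 ρ, (A φ : Y → ℂ) =ᵐ[ρ] fun x => ∫ y, K x y * φ y ∂ρ) →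
        A * F = F * A) ∧
      (∀ φ : Lp ℂ 2 ρ, ⟪φ, F φ⟫_ℂ = ∫ y, (w y : ℂ) * ((‖(φ : Y → ℂ) y‖ ^ 2 : ℝ) : ℂ) ∂ρ) := by
  intro Y _ ρ _ w hw hw1
  obtain ⟨F, hF⟩ := StubMulInvolutionOp.exists_clm_ae_mul (ρ := ρ) hw hw1
  exact ⟨F, hF, StubMulInvolutionOp.isSelfAdjoint_of_ae_mul hF,
    StubMulInvolutionOp.mul_self_of_ae_mul hw1 hF,
    fun K _ _ _ hKw A hA => StubMulInvolutionOp.mul_eq_mul_of_ae_kernel hF hKw hA,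
    fun φ => StubMulInvolutionOp.inner_self_apply_eq hF φ⟩

end Summit.QuantumFields.QCD.Cruxes.StableActionBridge.TwistedTraceTransfer

end
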